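import Literature.Topology.PlanarFoliations.TangentSign
import HarnessLib

/-!
# Bi-orientation of transversely oriented foliations of planar domains

Topic: Topology / PlanarFoliations. A foliation `F : Foliation ℝ X` with one-dimensional leaves
(`Literature/Topology/FourManifolds/TautFoliations.lean`) is **bi-oriented** when, besides being
transversely oriented, its flow boxes agree tangentially on overlaps (`IsBiOriented`: along the
common plaques the leaf coordinates increase together, `TangentSame` of `TangentSign.lean`) —
the changes of box have the form `(u, t) ↦ (g(u, t), γ(t))` with `g(·, t)` *and* `γ`
increasing. For such an atlas every leaf carries a canonical direction, which is what a
Poincaré–Bendixson theory needs.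

**Theorem** (`isBiOriented_biOrient`, **proved**): a transversely oriented foliation of a space
openly embedded in the plane (`ι : X → ℂ` an open embedding) becomes bi-oriented after
flipping the leaf coordinate of its flow boxes of negative parity
(`Literature/Topology/PlaneTopology/ChartParity.lean`): the new atlas `biOrient F ι` consists of
boxes of positive parity (`parity_pos_of_mem_biOrient`), two of which cannot disagree
tangentially by the chart-change formula (`parity_eq_neg_of_tangentOpp`), while any two boxes
agree or disagree (`tangentSame_or_tangentOpp`). The flipped atlas has the same sources, the
same heights, hence the same plaques and the **same leaves** (`leaf_biOrient`), and it is still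
transversely oriented (`isTransverselyOriented_biOrient`). This is the `C⁰` form of "a
transversely orientable foliation of an orientable surface is orientable" (Camacho–Lins Neto,
*Geometric Theory of Foliations*, Ch. VI §4 Prop. 2, for the singular foliations of the disc
induced on discs in general position; Hector–Hirsch A, Ch. II 2.2.8–2.2.9).

All statements are [folklore]; the construction is [cite: CamachoLinsNeto1985, Ch. VI §4 Prop. 2].
-/

noncomputable section

open Set Filter Metric Function Complex
open _root_.Topology
open scoped Real
open Literature.Topology.FourManifolds Literature.Topology.PlaneTopology

namespace Literature.Topology.PlanarFoliations

variable {X : Type*} [TopologicalSpace X]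

/-! ## Flipping the leaf coordinate of a flow box -/

/-- The flip of the leaf coordinate of the model plane, `(u, t) ↦ (-u, t)`. [folklore] -/
def flipRR : ℝ × ℝ ≃ₜ ℝ × ℝ := (Homeomorph.neg ℝ).prodCongr (Homeomorph.refl ℝ)

/-- `flipRR (u, t) = (-u, t)`. [folklore] -/
@[simp] theorem flipRR_apply (p : ℝ × ℝ) : flipRR p = (-p.1, p.2) := rfl

/-- `flipRR.symm (u, t) = (-u, t)`. [folklore] -/
@[simp] theorem flipRR_symm_apply (p : ℝ × ℝ) : flipRR.symm p = (-p.1, p.2) := rfl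

/-- The flow box with **flipped leaf coordinate**. [folklore] -/
def flipChart (e : OpenPartialHomeomorph X (ℝ × ℝ)) : OpenPartialHomeomorph X (ℝ × ℝ) :=
  e.transHomeomorph flipRR

variable {e e' : OpenPartialHomeomorph X (ℝ × ℝ)} {x : X}

/-- The flipped box reads `(-u, t)`. [folklore] -/
@[simp] theorem flipChart_apply (e : OpenPartialHomeomorph X (ℝ × ℝ)) (y : X) :
    flipChart e y = (-(e y).1, (e y).2) := rfl

/-- The inverse of the flipped box. [folklore] -/
@[simp] theorem flipChart_symm_apply (e : OpenPartialHomeomorph X (ℝ × ℝ)) (p : ℝ × ℝ) :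
    (flipChart e).symm p = e.symm (-p.1, p.2) := rfl

/-- The flipped box has the same source. [folklore] -/
@[simp] theorem flipChart_source (e : OpenPartialHomeomorph X (ℝ × ℝ)) : (flipChart e).source = e.source := rfl

/-- The flipped box of a box onto the whole plane is onto the whole plane. [folklore] -/
theorem flipChart_target (he : e.target = univ) : (flipChart e).target = univ := by
  simp [flipChart, he]

/-- **Flipping negates the parity**: the chart loop of the flipped box is the chart loop of
the box traversed backwards (`θ ↦ 1/2 - θ`). [folklore] -/
theorem parity_flipChart {ι : X → ℂ} (hι : IsOpenEmbedding ι) (he : e.target = univ) (hx : x ∈ e.source) :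
    parity ι (flipChart e) x = -parity ι e x := by
  set f : ℝ → ℂ := fun θ ↦ chartLoop ι e x 1 θ - ι x with hf
  have hfeq : (fun θ ↦ chartLoop ι (flipChart e) x 1 θ - ι x) = fun θ ↦ f (1 / 2 - θ) := by
    funext θ
    show _ = chartLoop ι e x 1 (1 / 2 - θ) - ι x
    rw [chartLoop_eq, chartLoop_eq, show 2 * π * (1 / 2 - θ) = π - 2 * π * θ by ring, Real.cos_pi_sub,
      Real.sin_pi_sub, flipChart_symm_apply, flipChart_apply]
    congr 3
    simp only
    ring_nf
  have hfc : Continuous f := (continuous_chartLoop hι.continuous he x 1).sub continuous_const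
  have hfp : Function.Periodic f 1 := fun θ ↦ by
    show chartLoop ι e x 1 (θ + 1) - ι x = chartLoop ι e x 1 θ - ι x
    rw [periodic_chartLoop x 1 θ]
  have hfne : ∀ θ, f θ ≠ 0 := fun θ ↦ sub_ne_zero.2 (chartLoop_ne hι.injective he hx one_ne_zero θ)
  show wind (fun θ ↦ chartLoop ι (flipChart e) x 1 θ - ι x) = -wind f
  rw [hfeq, wind_comp_const_sub (f := f) hfc hfp hfne]

/-! ## Bi-oriented atlases -/

/-- `F` is **bi-oriented**: any two flow boxes agree tangentially near every common point
(along the common plaques the leaf coordinates increase together). [folklore] -/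
def IsBiOriented (F : Foliation ℝ X) : Prop :=
  ∀ e ∈ F.atlas, ∀ e' ∈ F.atlas, ∀ x ∈ e.source ∩ e'.source, TangentSame e e' x

/-! ## The flipped atlas of a planar foliation -/

section BiOrient

variable (F : Foliation ℝ X) (ι : X → ℂ)

/-- The base point of a box onto the whole plane: the point of coordinates `(0, 0)`.
[folklore] -/
def basePt (e : OpenPartialHomeomorph X (ℝ × ℝ)) : X := e.symm (0, 0)

/-- The **oriented version** of a box: the box itself if its parity (at its base point, hence
everywhere on its source) is positive, the flipped box otherwise. [folklore] -/
def orientChart (e : OpenPartialHomeomorph X (ℝ × ℝ)) : OpenPartialHomeomorph X (ℝ × ℝ) := by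
  classical
  exact if 0 < parity ι e (basePt e) then e else flipChart e

/-- **The bi-oriented atlas**: the oriented versions of the boxes of `F`. [folklore] -/
def biOrient : Foliation ℝ X where
  atlas := orientChart ι '' F.atlas
  target_eq := by
    rintro _ ⟨e, he, rfl⟩
    unfold orientChart
    split_ifs
    · exact F.target_eq e he
    · exact flipChart_target (F.target_eq e he)
  exists_mem_source x := by
    obtain ⟨e, he, hx⟩ := F.exists_mem_source x
    refine ⟨orientChart ι e, mem_image_of_mem _ he, ?_⟩
    unfold orientChart
    split_ifs <;> exact hx
  locally_plaque := by
    rintro _ ⟨e, he, rfl⟩ _ ⟨e', he', rfl⟩ x hx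
    have hsrc : ∀ d : OpenPartialHomeomorph X (ℝ × ℝ), (orientChart ι d).source = d.source := fun d ↦ by
      unfold orientChart; split_ifs <;> rfl
    have hsnd : ∀ (d : OpenPartialHomeomorph X (ℝ × ℝ)) (y : X), (orientChart ι d y).2 = (d y).2 := fun d y ↦ by
      unfold orientChart; split_ifs <;> rfl
    rw [hsrc, hsrc] at hx
    obtain ⟨U, hU, h⟩ := F.locally_plaque e he e' he' x hx
    refine ⟨U, hU, fun y hy z hz hyz ↦ ?_⟩
    rw [hsrc, hsrc] at hy hz
    rw [hsnd, hsnd] at hyz ⊢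
    exact h y hy z hz hyz

variable {F ι}

/-- The oriented version of a box is the box or its flip. [folklore] -/
theorem orientChart_eq_or (e : OpenPartialHomeomorph X (ℝ × ℝ)) :
    orientChart ι e = e ∨ orientChart ι e = flipChart e := by
  unfold orientChart
  split_ifs
  · exact Or.inl rfl
  · exact Or.inr rfl

/-- The oriented version of a box has the same source. [folklore] -/
@[simp] theorem orientChart_source (e : OpenPartialHomeomorph X (ℝ × ℝ)) : (orientChart ι e).source = e.source := by
  rcases orientChart_eq_or (ι := ι) e with h | h <;> simp [h]

/-- The oriented version of a box has the same heights. [folklore] -/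
@[simp] theorem orientChart_snd (e : OpenPartialHomeomorph X (ℝ × ℝ)) (y : X) : (orientChart ι e y).2 = (e y).2 := by
  rcases orientChart_eq_or (ι := ι) e with h | h <;> simp [h]

/-- The boxes of the bi-oriented atlas. [folklore] -/
theorem mem_biOrient_atlas_iff {d : OpenPartialHomeomorph X (ℝ × ℝ)} :
    d ∈ (biOrient F ι).atlas ↔ ∃ e ∈ F.atlas, orientChart ι e = d := Iff.rfl

/-- **The bi-oriented atlas has the same plaque relation.** [folklore] -/
theorem samePlaque_biOrient_iff {x y : X} : (biOrient F ι).SamePlaque x y ↔ F.SamePlaque x y := by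
  constructor
  · rintro ⟨_, ⟨e, he, rfl⟩, hx, hy, h⟩
    rw [orientChart_source] at hx hy
    rw [orientChart_snd, orientChart_snd] at h
    exact ⟨e, he, hx, hy, h⟩
  · rintro ⟨e, he, hx, hy, h⟩
    refine ⟨orientChart ι e, mem_image_of_mem _ he, ?_, ?_, ?_⟩
    · rwa [orientChart_source]
    · rwa [orientChart_source]
    · rwa [orientChart_snd, orientChart_snd]

/-- **The bi-oriented atlas has the same leaves.** [folklore] -/
theorem leaf_biOrient (x : X) : (biOrient F ι).leaf x = F.leaf x := by
  ext y
  rw [Foliation.mem_leaf_iff, Foliation.mem_leaf_iff]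
  have h : (biOrient F ι).SamePlaque = F.SamePlaque := by
    funext a b
    exact propext samePlaque_biOrient_iff
  rw [h]

/-- **The bi-oriented atlas is transversely oriented** when `F` is (heights are unchanged).
[folklore] -/
theorem isTransverselyOriented_biOrient (ho : F.IsTransverselyOriented) : (biOrient F ι).IsTransverselyOriented := by
  rintro _ ⟨e, he, rfl⟩ _ ⟨e', he', rfl⟩ x hx
  rw [orientChart_source, orientChart_source] at hx
  obtain ⟨U, hU, h⟩ := ho e he e' he' x hx
  refine ⟨U, hU, fun y hy z hz hyz ↦ ?_⟩
  rw [orientChart_source, orientChart_source] at hy hz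
  rw [orientChart_snd, orientChart_snd] at hyz ⊢
  exact h y hy z hz hyz

/-- The base point lies in the source (box onto the whole plane). [folklore] -/
theorem basePt_mem_source (he : e.target = univ) : basePt e ∈ e.source :=
  e.map_target (by rw [he]; exact mem_univ _)

/-- **The boxes of the bi-oriented atlas have positive parity** at every point of their
source. [folklore] -/
theorem parity_pos_of_mem_biOrient (hι : IsOpenEmbedding ι) {d : OpenPartialHomeomorph X (ℝ × ℝ)}
    (hd : d ∈ (biOrient F ι).atlas) {y : X} (hy : y ∈ d.source) : 0 < parity ι d y := by
  obtain ⟨e, he, rfl⟩ := hd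
  have het := F.target_eq e he
  rw [orientChart_source] at hy
  have hconst := parity_eq_parity (ι := ι) hι.continuous hι.injective het hy (basePt_mem_source het)
  unfold orientChart
  split_ifs with h
  · rwa [hconst]
  · rw [parity_flipChart hι het hy, hconst]
    have hne := parity_ne_zero (x := basePt e) hι het (basePt_mem_source het)
    omega

/-- **The flipped atlas of a transversely oriented planar foliation is bi-oriented**: two of
its boxes agree or disagree tangentially near a common point (`tangentSame_or_tangentOpp`);
if they disagreed their parities would be opposite (`parity_eq_neg_of_tangentOpp`), but both
are positive. [cite: CamachoLinsNeto1985, Ch. VI §4 Prop. 2] -/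
theorem isBiOriented_biOrient (hι : IsOpenEmbedding ι) (ho : F.IsTransverselyOriented) :
    IsBiOriented (biOrient F ι) := by
  intro d hd d' hd' x hx
  rcases tangentSame_or_tangentOpp (F := biOrient F ι) hd hd' hx.1 hx.2 with h | h
  · exact h
  · exfalso
    have h₁ := parity_eq_neg_of_tangentOpp (F := biOrient F ι) hι (isTransverselyOriented_biOrient ho)
      hd' hd hx.2 hx.1 h
    have h₂ := parity_pos_of_mem_biOrient hι hd hx.1
    have h₃ := parity_pos_of_mem_biOrient hι hd' hx.2
    omega

end BiOrient

end Literature.Topology.PlanarFoliations
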